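import Summits.Ventures.CertifiedArithmetic.LowPrec.GemmBinary16Step
import Summits.Ventures.CertifiedArithmetic.LowPrec.GemmThetaE2M1Data

/-!
# The θ-certificate of E2M1²→binary16 sequential accumulation: data and Boolean checkers

HONEST FRAMING (venture CertifiedArithmetic / cell `pub-lowprec`, seat gemm, gen 10): certified error
envelopes and provably optimal rounding/accumulation schemes for low-precision formats under stated
cost models; every table by two implementations; no hardware or vendor claims.

Paper `gemm.tex` §Regimes, Prop. Θ(i) for the configuration E2M1·E2M1 products accumulated
sequentially in IEEE `binary16` under round-to-nearest-even — in the cell's Lean model `roundNE`,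
which saturates at `±65504` (on inputs none of whose partial sums reaches the overflow threshold
`65520`, the paper's `FIN(n)`, this is IEEE arithmetic; the saturating transitions are self-loops of
the two states `±65504` and are covered by the certificate like every other absorption).  Grid: every
product is `Q/4` with `Q` one of the 37 integers of `ThetaE2M1.lamQ` (`GemmThetaE2M1Data.lean`,
`|Q| ≤ 144`).  The accumulator graph has the 18431 states `S = {±v : v ∈ ¼ℤ ∩ binary16}` — EVERY
`binary16` value on the quarter grid is reachable — indexed `i < 9216` ↦ magnitude `valG i` in quarter
units: `i` itself below `2048` (`v < 512`, where the quarter grid is finer than the format), then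
7 binades of 1024 values `(1024 + t)·2^e`, `e = 1..7`, the last one ending at `4 · 65504`; there is
no separate top state.  The potential `Φ` of the certificate (computed by the cell's two
implementations `code/gemm/theta_{a,b}.py`) has on this graph the CLOSED FORM `psiNat` — `Φ(v) = v`
below `512` and `base_e + sOdd_e·⌈t/2⌉` on binade `e` (seven pairs of integers; inside a binade the
potential increases only on passing to an odd significand) — which the generator
`code/gemm/lean_theta/fp16/gen_fp16.py` (implementation C: its own integer rounding, checked equal to
a saturating binary16 RNE formula on 95,000 grid points incl. the top and every binade edge; its own
edge classification; `θ` recomputed as `min Φ/c = 833/4`, attained only at `v = 32832`, `c = 16`, `Φ = 3332`) asserted equal to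
the implementations' table at all 9216 magnitudes; it is merely TRANSCRIBED here: the kernel re-verifies
every inequality `Φ` is used in.  `edgeOK` is the Boolean checker of the seven finite facts behind
Prop. Θ(i) with the constants `θ = 833/4`, `ρ = 7/2`, `β_pair = 23/2`, `κ = 4/833` (scaled to integer
inequalities in quarter units): closure of `S` under every letter, the potential inequality
`Φ(w) ≤ Φ(v) + d` along moves, the capacity inequality `θ|q| ≤ Φ(v)` at absorptions of negative
letters, `δ ≤ ρ d` on paid moves, and for free moves (`d = 0`) `δ ≤ κ Φ(v)` and `δ + δ' ≤ β_pair d'`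
for every next move.  The files `GemmThetaE2M1Fp16Check*.lean` check all `2 · 9216 · 37 = 681,984`
edges (and the successor edges of the 7167 free moves) by `decide +kernel` through the
saturating integer rounding `rneB16 2` (`GemmBinary16Step.lean`: RNE to 11 significant bits, binade by
`Nat.log2`, inputs at or above `4 · 65504` to the top); `GemmThetaE2M1Fp16.lean` turns them into the
hypotheses of the generic soundness theorem via `flStep_binary16`.
-/

namespace Literature.ComputerArithmetic.FloatingPoint

namespace MiniFloat

namespace ThetaE2M1Fp16

open ThetaE2M1 (lamQ)

/-- Magnitude (quarter units) of the nonnegative state with index `i < 9216`: `i` itself below `2048`,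
then 7 binades of 1024 values `(1024 + t) · 2^e` (`e = 1..7`; larger indices continue the pattern and
are not states). [cell, gemm.tex §Regimes] -/
def valG (i : ℕ) : ℕ :=
  if i < 2048 then i else (1024 + (i - 2048) % 1024) * 2 ^ ((i - 2048) / 1024 + 1)

/-- Index of a magnitude (a left inverse of `valG` on its image; other inputs are caught by the
closure check `valG (idxG n) = n ∧ idxG n < 9216`); binade by `Nat.log2`. [cell] -/
def idxG (n : ℕ) : ℕ :=
  if n < 2048 then n else let k := Nat.log2 n - 10; 2048 + 1024 * (k - 1) + (n / 2 ^ k - 1024)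

/-- Closed-form potential, per binade `e = 1..7`: the value at `t = 0`. [cell certificate
certs/gemm/regimes/theta_ocp_e2m1_ocp_e2m1_binary16 — transcribed] -/
def psiBase : List ℤ :=
  [2048, 3072, 4096, 6144, 7168, 9216, 13312]

/-- Closed-form potential, per binade: the increment at odd `t` (none at even `t`).
[cell certificate — transcribed] -/
def psiOdd : List ℤ :=
  [2, 2, 4, 2, 4, 8, 16]

/-- `4 · Φ` at a nonnegative magnitude `n` (quarter units): `n` itself below `2048` (the exact region
`Φ(v) = v`, `v < 512`), else the closed form of its binade. [cell] -/
def psiNat (n : ℕ) : ℤ :=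
  if n < 2048 then (n : ℤ)
  else
    let k := Nat.log2 n - 10
    let t := n / 2 ^ k - 1024
    psiBase.getD (k - 1) 0 + psiOdd.getD (k - 1) 0 * (((t + 1) / 2 : ℕ) : ℤ)

/-- `4 · Φ` at a signed state `V` (quarter units): `|V|` on the nonpositive side. [cell] -/
def psiZ (V : ℤ) : ℤ :=
  if V < 0 then -V else psiNat V.toNat

/-- The signed state with sign `σ` and index `i`. [cell] -/
def sval (σ : Bool) (i : ℕ) : ℤ :=
  if σ then -((valG i : ℕ) : ℤ) else ((valG i : ℕ) : ℤ)

/-- Successor state of `(σ, i)` under the letter `Q` (quarter units, saturating). [cell] -/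
def WQ (σ : Bool) (i : ℕ) (Q : ℤ) : ℤ := rneB16 2 (sval σ i + Q)

/-- Gain `4δ` of the edge `(σ, i) → WQ` under `Q`. [cell, gemm.tex §Regimes] -/
def gainQ (σ : Bool) (i : ℕ) (Q : ℤ) : ℤ := WQ σ i Q - sval σ i - Q

/-- Deficit `4d = 4(|q| - δ)` of the edge. [cell, gemm.tex §Regimes] -/
def defQ (σ : Bool) (i : ℕ) (Q : ℤ) : ℤ := (Q.natAbs : ℤ) - gainQ σ i Q

/-- PAIR CHECK after a free move ending at `W` with gain `δf`: every letter `Q'` that moves `W`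
satisfies `2 (δf + δ') ≤ 23 d'` (`β_pair = 23/2`). [cell, gemm.tex Lemma "moving walks"] -/
def pairOK (W δf : ℤ) : Bool :=
  lamQ.all fun Q' =>
    decide (rneB16 2 (W + Q') = W) ||
      decide (2 * (δf + (rneB16 2 (W + Q') - W - Q'))
        ≤ 23 * ((Q'.natAbs : ℤ) - (rneB16 2 (W + Q') - W - Q')))

/-- EDGE CHECK of the state `(σ, i)` under the letter `Q` (quarter units; `θ = 833/4`, `ρ = 7/2`,
`κ = 4/833`): at an absorption of a negative letter `833 · |Q| ≤ 4 · Φ`; at a move, closure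
(`WQ` is a state), the potential inequality, and `2δ ≤ 7d` if paid, `833 δ ≤ 4 Φ(v)` plus
`pairOK` if free. [cell, gemm.tex §Regimes] -/
def edgeOK (σ : Bool) (i : ℕ) (Q : ℤ) : Bool :=
  if WQ σ i Q = sval σ i then decide (0 ≤ Q) || decide (833 * -Q ≤ 4 * psiZ (sval σ i))
  else
    decide (idxG (WQ σ i Q).natAbs < 9216) &&
    decide (valG (idxG (WQ σ i Q).natAbs) = (WQ σ i Q).natAbs) &&
    decide (psiZ (WQ σ i Q) ≤ psiZ (sval σ i) + defQ σ i Q) &&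
    (if 0 < defQ σ i Q then decide (2 * gainQ σ i Q ≤ 7 * defQ σ i Q)
      else decide (833 * gainQ σ i Q ≤ 4 * psiZ (sval σ i)) && pairOK (WQ σ i Q) (gainQ σ i Q))

/-- ROW CHECK: every letter, both signs, for the state indices in `[a, a + l)`. [cell] -/
def rowsOK (a l : ℕ) : Bool :=
  (List.range' a l).all fun i => lamQ.all fun Q => edgeOK false i Q && edgeOK true i Q

/-- Row checks concatenate (explicit lengths). [folklore] -/
theorem rowsOK_append (a l₁ l₂ : ℕ) (h₁ : rowsOK a l₁ = true) (h₂ : rowsOK (a + l₁) l₂ = true) :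
    rowsOK a (l₁ + l₂) = true := by
  unfold rowsOK at h₁ h₂ ⊢
  rw [List.all_eq_true] at h₁ h₂ ⊢
  intro i hi
  rw [List.mem_range'_1] at hi
  by_cases h : i < a + l₁
  · exact h₁ i (List.mem_range'_1.mpr ⟨hi.1, h⟩)
  · exact h₂ i (List.mem_range'_1.mpr ⟨not_lt.mp h, by omega⟩)

/-- START CHECK of a letter `Q`: it is a `binary16` value (`rneB16 2 Q = Q`), a state, and
`Φ(q) ≤ |q|`. [cell] -/
def startOK (Q : ℤ) : Bool :=
  decide (rneB16 2 Q = Q) && decide (idxG Q.natAbs < 9216) &&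
    decide (valG (idxG Q.natAbs) = Q.natAbs) && decide (psiZ Q ≤ (Q.natAbs : ℤ))

/-- Every letter passes the start check. [cell certificate, kernel-checked] -/
theorem starts_ok (Q : ℤ) (hQ : Q ∈ lamQ) : startOK Q = true := by
  have h : (lamQ.all fun Q => startOK Q) = true := by decide +kernel
  exact List.all_eq_true.mp h Q hQ

end ThetaE2M1Fp16

end MiniFloat

end Literature.ComputerArithmetic.FloatingPoint
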